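import Literature.NumberTheory.LFunctions.RodgersTaoHamiltonian
import Literature.NumberTheory.LFunctions.RodgersTaoHolds
import Literature.NumberTheory.LFunctions.RodgersTaoRiemannVonMangoldtProofs
import Mathlib.Analysis.Calculus.Deriv.MeanValue
import Mathlib.Analysis.PSeries
import HarnessLib

/-!
# Rodgers–Tao 2020, §7 — proofs: the remaining regimes of (70) and the two `ξ`-displays of the
proof of Lemma 21 (CONTENT, RH-FREE), and the discharge of the §7 named facts under the refuted
standing hypothesis (EX-FALSO, vacuous range)

Proofs only (no public definitions, no named facts; a few `private def` majorants serve the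
summations). Trunk T-ANT (`Literature/NumberTheory/LFunctions`).
Companion of `RodgersTaoHamiltonian.lean`, which types §7 of B. Rodgers, T. Tao, *The de
Bruijn–Newman constant is non-negative*, Forum Math. Pi 8 (2020) e6 = arXiv:1801.05914 (Lemma 16
– Corollary 25, FMP pp. 39–57) as printed.

LINE 1 — LABEL. (a) **CONTENT (RH-FREE)**: the two lower bounds of display (70) that the statement
file left open — `log₊(1/|x|)/8 ≤ L(x)` for `0 < |x| ≤ 1/2` and `(|x| − 1)²/4 ≤ L(x)` for
`0 < |x| ≤ 2` — are real proofs (elementary calculus), completing the tree's rendering of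
«`L(x) ≍ log₊(1/|x|)`, `≍ (|x| − 1)²`, `≍ |x|`» with explicit constants; and the two RH-FREE
displays of the proof of Lemma 21 (FMP p. 47) about the classical locations only —
`rodgers_tao_xi_inv_sq_sum_bound` (`Σ_{k ∈ ℤ* ∖ {j}} 1/|ξ_j − ξ_k|² ≲ log₊² j`) and
`rodgers_tao_truncWeight_xi_sq_sum_bound` (`Σ_{j ≠ k} ψ_T(j)ψ_T(k)/|ξ_j − ξ_k|² ≲ T log³ T`) — are
DISCHARGED by real proofs from (43)–(44) (Rodgers–Tao Lemma 8, tree: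
`RodgersTao2020.lemma31_i_order_holds`, `RodgersTao2020.lemma31_ii_holds`, themselves proved in
`RodgersTaoRiemannVonMangoldtProofs.lean`); no hypothesis on `Λ` is used. (b) **EX-FALSO (vacuous
range)**: the nine witness-form named facts of `RodgersTaoHamiltonian.lean` (Lemma 16, 18, 19,
20, 21 (`x`-part and `ξ`-clause), Prop. 22, Lemma 24, Cor. 25) are implications from
`t₀ < 0 ∧ HasOnlyRealZeros (deBruijnH t₀)`, i.e. from the paper's standing hypothesis `Λ < 0`
(§1.2), which is REFUTED in the tree: `rodgers_tao_holds` (Newman's conjecture `Λ ≥ 0`,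
Rodgers–Tao Thm. 1, proved along A. Dobner, Acta Arith. 201 (2021) — a route that uses no
Rodgers–Tao fact). Each of them therefore holds, ex falso, exactly as the §§8–9 facts were
discharged in `RodgersTaoEnergyProofs.lean` / `RodgersTaoHolds.lean`. THESE DISCHARGES HAVE ZERO
CONTENT: they do not formalise the §7 argument (which runs from (50)–(52), Prop. 13, Prop. 15 and
(56)); they only record that, `Λ ≥ 0` being a theorem, the printed `Λ/2 ≤ t ≤ 0` statements are
vacuously true (rt/README §0.4; RT Remark 5). With this file every named fact of
`RodgersTaoHamiltonian.lean` has a `_holds` (net Literature debt of §7: zero).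
Nothing in this file bears on the truth of the Riemann hypothesis.

## Contents

* `logPlus_inv_div_eight_le_renormLog` — (70), small regime, lower bound (CONTENT).
* `sq_sub_one_div_four_le_renormLog` — (70), middle regime, lower bound (CONTENT).
* `exists_abs_classicalLocationZ_le` (`|ξ_k| ≤ B|k|` on `ℤ`, from (43)),
  `logPlus_le_logPlus_add_logPlus_sub`; `rodgers_tao_xi_inv_sq_sum_bound_holds`,
  `rodgers_tao_truncWeight_xi_sq_sum_bound_holds` — Lemma 21 proof, p. 47 (CONTENT, RH-FREE).
* `rodgers_tao_renormEnergyOn_expansion_holds` (Lemma 16), `rodgers_tao_truncEnergy_expansion_holds`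
  (Lemma 18), `rodgers_tao_truncHamiltonian_expansion_holds` (Lemma 19),
  `rodgers_tao_renormHamiltonian_decay_holds` (Lemma 20), `rodgers_tao_moderatelySized_holds`
  (Lemma 21, `x`-part), `rodgers_tao_moderatelySized_xi_holds` (Lemma 21, `ξ`-clause as printed),
  `rodgers_tao_truncHamiltonian_deriv_holds` (Prop. 22),
  `rodgers_tao_truncEnergy_lower_bound_holds` (Lemma 24), `rodgers_tao_truncHamiltonian_bound_holds`
  (Cor. 25) — EX-FALSO (vacuous range), via `rodgers_tao_holds`.

## References

* B. Rodgers, T. Tao, *The de Bruijn–Newman constant is non-negative*, Forum Math. Pi 8 (2020)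
  e6, §1.2 (standing hypothesis, `log₊`), Remark 5 p. 8, §3 Lemma 8 (43)–(44) p. 21, §7
  pp. 39–57 ((66) p. 42, (70) p. 44, Lemma 21 proof p. 47; Lemma 16 – Cor. 25)
  = arXiv:1801.05914v4 §7.
* A. Dobner, *A proof of Newman's conjecture for the extended Selberg class*, Acta Arith. 201
  (2021) 29–62 (the route of `rodgers_tao_holds`).
-/

noncomputable section

open Real Filter Set Topology

namespace Literature.NumberTheory.LFunctions

/-! ## (70): the two remaining lower bounds (CONTENT, RH-FREE) -/

/-- CONTENT (RH-FREE). (70), small regime, lower bound: `log₊(1/|x|)/8 ≤ L(x)` for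
`0 < |x| ≤ 1/2`. Proof: with `u = |x|`, `log(1/u) ≥ log 2 + (1 − 2u)` (from `log y ≥ 1 − 1/y` at
`y = 1/(2u)`), whence `1 − u ≤ (3/4) log(1/u)` (using `log 2 > 0.69`), so
`L = log(1/u) − (1 − u) ≥ log(1/u)/4 ≥ log₊(1/u)/8` (as `2 + 1/u ≤ 2/u` and `log 2 ≤ log(1/u)`).
[cite: RodgersTaoFMP2020, §7 p. 44 (70)] -/
theorem logPlus_inv_div_eight_le_renormLog {x : ℝ} (hx : x ≠ 0) (h : |x| ≤ 1 / 2) :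
    logPlus (1 / |x|) / 8 ≤ renormLog x := by
  set u := |x| with hu
  have hu0 : 0 < u := abs_pos.2 hx
  have hlog2 : (0.6931471803 : ℝ) < Real.log 2 := Real.log_two_gt_d9
  -- `log (1/(2u)) ≥ 1 - 2u`
  have h1 : 1 - 2 * u ≤ Real.log (1 / (2 * u)) := by
    have := Real.log_le_sub_one_of_pos (show 0 < 2 * u by positivity)
    rw [one_div, Real.log_inv]
    linarith
  have h2 : Real.log (1 / (2 * u)) = Real.log (1 / u) - Real.log 2 := by
    rw [one_div, one_div, Real.log_inv, Real.log_inv, Real.log_mul two_ne_zero hu0.ne']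
    ring
  have h3 : Real.log 2 ≤ Real.log (1 / u) :=
    Real.log_le_log two_pos (by rw [le_div_iff₀ hu0]; linarith)
  have hune : u ≠ 0 := hu0.ne'
  have h4 : logPlus (1 / u) ≤ 2 * Real.log (1 / u) := by
    rw [logPlus_eq, abs_of_pos (one_div_pos.2 hu0)]
    have h5 : 2 + 1 / u ≤ 2 / u := by
      rw [show (2 : ℝ) + 1 / u = (2 * u + 1) / u by field_simp, div_le_div_iff_of_pos_right hu0]
      linarith
    calc Real.log (2 + 1 / u) ≤ Real.log (2 / u) := Real.log_le_log (by positivity) h5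
      _ = Real.log 2 + Real.log (1 / u) := by
          rw [div_eq_mul_one_div, Real.log_mul two_ne_zero (one_div_pos.2 hu0).ne']
      _ ≤ 2 * Real.log (1 / u) := by linarith
  have hL : renormLog x = Real.log (1 / u) - (1 - u) := by
    rw [renormLog_eq_def]; ring
  rw [hL]
  linarith

/-- CONTENT (RH-FREE). (70), middle regime, lower bound: `(|x| − 1)²/4 ≤ L(x)` for `0 < |x| ≤ 2`
(printed for `1/2 < |x| ≤ 2`). Proof: `g(u) := L(u) − (u − 1)²/4` has `g(1) = 0` and
`g'(u) = (u − 1)(2 − u)/(2u)`, `≤ 0` on `(0, 1)` and `≥ 0` on `(1, 2)`.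
[cite: RodgersTaoFMP2020, §7 p. 44 (70)] -/
theorem sq_sub_one_div_four_le_renormLog {x : ℝ} (hx : x ≠ 0) (h : |x| ≤ 2) :
    (|x| - 1) ^ 2 / 4 ≤ renormLog x := by
  rw [renormLog_eq]
  set u := |x| with hu
  have hu0 : 0 < u := abs_pos.2 hx
  let g : ℝ → ℝ := fun v ↦ v - 1 - Real.log v - (v - 1) ^ 2 / 4
  have hg1 : g 1 = 0 := by simp [g]
  have hderiv : ∀ v : ℝ, 0 < v →
      HasDerivAt g (1 - v⁻¹ - ((2 : ℕ) * (v - 1) ^ (2 - 1) * 1 / 4)) v := fun v hv ↦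
    (((hasDerivAt_id' v).sub_const 1).sub (Real.hasDerivAt_log hv.ne')).sub
      ((((hasDerivAt_id' v).sub_const 1).pow 2).div_const 4)
  have hcont : ContinuousOn g (Ioi 0) :=
    fun v hv ↦ (hderiv v hv).continuousAt.continuousWithinAt
  have hdiff : ∀ v : ℝ, 0 < v → DifferentiableAt ℝ g v :=
    fun v hv ↦ (hderiv v hv).differentiableAt
  have hderiv_eq : ∀ v : ℝ, 0 < v → deriv g v = (v - 1) * (2 - v) / (2 * v) := by
    intro v hv
    rw [(hderiv v hv).deriv]
    have hv' : v ≠ 0 := hv.ne'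
    norm_num
    field_simp
    ring
  suffices 0 ≤ g u by
    simp only [g] at this
    linarith
  rcases le_or_gt 1 u with h1u | hu1
  · -- increasing on [1, 2]
    have hmono : MonotoneOn g (Icc 1 2) := by
      refine monotoneOn_of_deriv_nonneg (convex_Icc 1 2)
        (hcont.mono fun v hv ↦ lt_of_lt_of_le one_pos hv.1) ?_ ?_
      · intro v hv
        rw [interior_Icc] at hv
        exact (hdiff v (one_pos.trans hv.1)).differentiableWithinAt
      · intro v hv
        rw [interior_Icc] at hv
        rw [hderiv_eq v (one_pos.trans hv.1)]
        exact div_nonneg (mul_nonneg (by linarith [hv.1]) (by linarith [hv.2]))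
          (by linarith [hv.1])
    have := hmono ⟨le_rfl, by norm_num⟩ ⟨h1u, h⟩ h1u
    rwa [hg1] at this
  · -- decreasing on (0, 1]
    have hanti : AntitoneOn g (Ioc 0 1) := by
      refine antitoneOn_of_deriv_nonpos (convex_Ioc 0 1) (hcont.mono fun v hv ↦ hv.1) ?_ ?_
      · intro v hv
        rw [interior_Ioc] at hv
        exact (hdiff v hv.1).differentiableWithinAt
      · intro v hv
        rw [interior_Ioc] at hv
        rw [hderiv_eq v hv.1]
        exact div_nonpos_of_nonpos_of_nonneg
          (mul_nonpos_of_nonpos_of_nonneg (by linarith [hv.2]) (by linarith [hv.2])) (by linarith [hv.1])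
    have := hanti ⟨hu0, hu1.le⟩ ⟨one_pos, le_rfl⟩ hu1.le
    rwa [hg1] at this

/-! ## Lemma 21, proof: the two RH-FREE displays about `ξ_j` (CONTENT, from (43)–(44))

Part 1 — `Σ_{k ∈ ℤ* ∖ {j}} 1/|ξ_j − ξ_k|² ≲ log₊² j` (FMP p. 47, last display but one; printed
«from Lemma 8 (ii)»). Proof as printed, made explicit: (44) gives
`|ξ_k − ξ_j| ≥ c|k − j|/log₊(|ξ_j| + |ξ_k|)`, and `log₊(|ξ_j| + |ξ_k|) ≤ A + log₊ j + log₊ k ≤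
A + 2 log₊ j + log₊(k − j)` by (43) (`|ξ_k| ≤ B|k|`) and subadditivity of `log₊`; hence
`1/|ξ_j − ξ_k|² ≤ (2(A + 2 log₊ j)² + 2 log₊²(k − j))/(c²(k − j)²)`, and `Σ_h 1/h²`,
`Σ_h log₊² h/h² < ∞`. Part 2 — `Σ_{j ≠ k} ψ_T(j)ψ_T(k)/|ξ_j − ξ_k|² ≲ T log³ T` (p. 47, the display
before): `ψ_T(k) ≤ 1`, Part 1, and `Σ_j ψ_T(j) log₊² j ≤ 100 · T log³ T` for `T ≥ 3` (from
`log₊ j ≤ log(2 + T log T) + |j|/(T log T)` and `Σ_{n ≥ 0} (1 + n/N)^{−98} ≤ 5N`, `N ≥ 1`,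
by comparison with `N² Σ_{n > N} 1/n² ≤ 2N`). -/

/-! ### Bridges to the §3 file's namespaced copies (R1c: the root names are of record) -/

/-- R1c bridge (by `rfl`): the §3 file's namespaced `log₊` is the tree's `logPlus` of record.
[cite: RodgersTaoFMP2020, §1.2 p. 7] -/
private theorem rt2020_logPlus_eq : RodgersTao2020.logPlus = logPlus := rfl
/-- R1c bridge (by `rfl`): the §3 file's namespaced `ξ_j` on `ℤ*` is the tree's
`classicalLocationZ` of record. [cite: RodgersTaoFMP2020, §3 (42) p. 21] -/
private theorem rt2020_classicalLocationInt_eq :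
    RodgersTao2020.classicalLocationInt = classicalLocationZ := rfl

/-! ### Step 1: `|ξ_k| ≤ B |k|` on `ℤ` -/

/-- Auxiliary (proof-internal). [folklore] -/
private theorem abs_classicalLocationZ_eq (k : ℤ) :
    |classicalLocationZ k| = classicalLocation (k.natAbs : ℝ) ∨ k = 0 := by
  rcases eq_or_ne k 0 with rfl | hk
  · exact Or.inr rfl
  · left
    rw [classicalLocationZ, abs_mul]
    have hpos : 0 ≤ classicalLocation (k.natAbs : ℝ) :=
      (classicalLocation_pos (by have : (0:ℝ) ≤ k.natAbs := Nat.cast_nonneg _; linarith)).le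
    rw [abs_of_nonneg hpos]
    rcases lt_or_gt_of_ne hk with h | h
    · rw [Int.sign_eq_neg_one_of_neg h]; simp
    · rw [Int.sign_eq_one_of_pos h]; simp

/-- RH-FREE, CONTENT. `|ξ_k| ≤ B |k|` on all of `ℤ` for some absolute `B > 0` — from the upper half
of Rodgers–Tao 2020, Lemma 8 (i), display (43) (`ξ_j ≤ C j/log₊ j`, FMP p. 21; tree:
`RodgersTao2020.lemma31_i_order_holds`) and `log₊ ≥ log 2`, extended oddly to `ℤ*` and by
`ξ_0 := 0`.
[cite: RodgersTaoFMP2020, §3 Lemma 8 (i) (43) p. 21] -/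
theorem exists_abs_classicalLocationZ_le :
    ∃ B : ℝ, 0 < B ∧ ∀ k : ℤ, |classicalLocationZ k| ≤ B * |(k : ℝ)| := by
  obtain ⟨c, C, hc, hcC, hord⟩ := RodgersTao2020.lemma31_i_order_holds
  refine ⟨C / Real.log 2, div_pos (hc.trans_le hcC) (Real.log_pos one_lt_two), fun k ↦ ?_⟩
  rcases eq_or_ne k 0 with rfl | hk
  · simp [classicalLocationZ]
  have hk1 : (1 : ℝ) ≤ (k.natAbs : ℝ) := by
    have : 1 ≤ k.natAbs := Int.natAbs_pos.2 hk
    exact_mod_cast this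
  obtain ⟨-, hup, -, -⟩ := hord (k.natAbs : ℝ) hk1
  have habs : |classicalLocationZ k| = classicalLocation (k.natAbs : ℝ) := by
    rcases abs_classicalLocationZ_eq k with h | h
    · exact h
    · exact absurd h hk
  have hcast : ((k.natAbs : ℕ) : ℝ) = |(k : ℝ)| := by
    rw [Nat.cast_natAbs, Int.cast_abs]
  rw [habs]
  have hL : Real.log 2 ≤ RodgersTao2020.logPlus (k.natAbs : ℝ) :=
    RodgersTao2020.log_two_le_logPlus _
  have hlog2 : 0 < Real.log 2 := Real.log_pos one_lt_two
  have hC : 0 ≤ C := (hc.trans_le hcC).le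
  calc classicalLocation (k.natAbs : ℝ)
      ≤ C * ((k.natAbs : ℝ) / RodgersTao2020.logPlus (k.natAbs : ℝ)) := hup
    _ ≤ C * ((k.natAbs : ℝ) / Real.log 2) := by
        gcongr
    _ = C / Real.log 2 * |(k : ℝ)| := by rw [hcast]; ring

/-! ### Step 2: `log₊ k ≤ log₊ j + log₊ (k − j)`, `log₊(|ξ_j| + |ξ_k|) ≤ A + log₊ j + log₊ k` -/

/-- RH-FREE (notation of §1.2). Subadditivity of `log₊` under translation:
`log₊ k ≤ log₊ j + log₊ (k − j)` (as `2 + |k| ≤ (2 + |j|)(2 + |k − j|)`).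
[cite: RodgersTaoFMP2020, §1.2 p. 7] -/
theorem logPlus_le_logPlus_add_logPlus_sub (j k : ℝ) :
    logPlus k ≤ logPlus j + logPlus (k - j) := by
  rw [logPlus_eq, logPlus_eq, logPlus_eq, ← Real.log_mul (by positivity) (by positivity)]
  refine Real.log_le_log (by positivity) ?_
  have h1 : |k| ≤ |j| + |k - j| := by
    have := abs_add_le j (k - j); simpa using this
  nlinarith [abs_nonneg j, abs_nonneg (k - j)]

/-- Auxiliary (proof-internal). [folklore] -/
private theorem logPlus_sum_le {B : ℝ} (hB : 0 < B) {a b j k : ℝ} (ha : |a| ≤ B * |j|)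
    (hb : |b| ≤ B * |k|) :
    logPlus (|a| + |b|) ≤ Real.log (2 + B) + logPlus j + logPlus k := by
  rw [logPlus_eq, logPlus_eq, logPlus_eq, abs_of_nonneg (by positivity : (0:ℝ) ≤ |a| + |b|),
    ← Real.log_mul (by positivity) (by positivity), ← Real.log_mul (by positivity) (by positivity)]
  refine Real.log_le_log (by positivity) ?_
  nlinarith [abs_nonneg j, abs_nonneg k, mul_nonneg (abs_nonneg j) (abs_nonneg k),
    mul_nonneg hB.le (mul_nonneg (abs_nonneg j) (abs_nonneg k))]

/-! ### Step 3: the pointwise bound from (44) -/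

/-- The pointwise consequence of (44): `1/|ξ_j − ξ_k|² ≤ (A + log₊ j + log₊ k)²/(c²(k − j)²)` for
`j, k ∈ ℤ*`, `j ≠ k`. [cite: RodgersTaoFMP2020, §3 Lemma 8 (ii) (44) p. 21] -/
private theorem exists_inv_sq_le :
    ∃ c A : ℝ, 0 < c ∧ 0 ≤ A ∧ ∀ j k : ℤ, j ≠ 0 → k ≠ 0 → k ≠ j →
      1 / (classicalLocationZ j - classicalLocationZ k) ^ 2 ≤
        (A + logPlus j + logPlus k) ^ 2 / (c ^ 2 * ((k : ℝ) - j) ^ 2) := by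
  obtain ⟨c, C, hc, hcC, h44⟩ := RodgersTao2020.lemma31_ii_holds
  obtain ⟨B, hB, hBle⟩ := exists_abs_classicalLocationZ_le
  refine ⟨c, Real.log (2 + B), hc, Real.log_nonneg (by linarith), fun j k hj hk hkj ↦ ?_⟩
  obtain ⟨hlow, -⟩ := h44 j k hj hk
  rw [rt2020_classicalLocationInt_eq, rt2020_logPlus_eq] at hlow
  set L := logPlus (|classicalLocationZ j| + |classicalLocationZ k|) with hL
  have hLpos : 0 < L := logPlus_pos _
  have hkj' : (0 : ℝ) < |(k : ℝ) - j| := by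
    rw [abs_pos, sub_ne_zero]; exact_mod_cast hkj
  -- from (44): c |k-j| / L ≤ |ξ_k - ξ_j|
  have h1 : c * |(k : ℝ) - j| / L ≤ |classicalLocationZ k - classicalLocationZ j| := by
    rw [mul_div_assoc]; exact hlow
  have h2 : 0 < c * |(k : ℝ) - j| / L := by positivity
  have h3 : (c * |(k : ℝ) - j| / L) ^ 2 ≤ (classicalLocationZ j - classicalLocationZ k) ^ 2 := by
    have := pow_le_pow_left₀ h2.le h1 2
    rw [sq_abs] at this
    calc _ ≤ (classicalLocationZ k - classicalLocationZ j) ^ 2 := this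
      _ = _ := by ring
  have hLle : L ≤ Real.log (2 + B) + logPlus j + logPlus k := logPlus_sum_le hB (hBle j) (hBle k)
  calc 1 / (classicalLocationZ j - classicalLocationZ k) ^ 2
      ≤ 1 / (c * |(k : ℝ) - j| / L) ^ 2 := by
        exact one_div_le_one_div_of_le (by positivity) h3
    _ = L ^ 2 / (c ^ 2 * ((k : ℝ) - j) ^ 2) := by
        rw [div_pow, mul_pow, sq_abs]; field_simp
    _ ≤ (Real.log (2 + B) + logPlus j + logPlus k) ^ 2 / (c ^ 2 * ((k : ℝ) - j) ^ 2) := by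
        gcongr

/-! ### Step 4: summability over `ℤ` of `1/h²` and `log₊² h / h²` -/

/-- Auxiliary (proof-internal). [folklore] -/
private theorem summable_one_div_int_sq : Summable (fun h : ℤ ↦ 1 / (h : ℝ) ^ 2) :=
  Real.summable_one_div_int_pow.2 (by norm_num)

/-- Auxiliary (proof-internal). [folklore] -/
private theorem logPlus_sq_le (h : ℝ) : logPlus h ^ 2 ≤ 16 * (2 + |h|) ^ (1 / 2 : ℝ) := by
  have h0 : (0 : ℝ) ≤ 2 + |h| := by positivity
  have h1 : Real.log (2 + |h|) ≤ 4 * (2 + |h|) ^ (1 / 4 : ℝ) := by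
    have := Real.log_le_rpow_div h0 (by norm_num : (0 : ℝ) < 1 / 4)
    linarith
  have h2 : 0 ≤ Real.log (2 + |h|) := Real.log_nonneg (by linarith [abs_nonneg h])
  rw [logPlus_eq]
  have h3 : ((2 + |h|) ^ (1 / 4 : ℝ)) ^ 2 = (2 + |h|) ^ (1 / 2 : ℝ) := by
    rw [← Real.rpow_natCast, ← Real.rpow_mul h0]; norm_num
  calc Real.log (2 + |h|) ^ 2 ≤ (4 * (2 + |h|) ^ (1 / 4 : ℝ)) ^ 2 :=
        pow_le_pow_left₀ h2 h1 2
    _ = 16 * (2 + |h|) ^ (1 / 2 : ℝ) := by rw [mul_pow, h3]; norm_num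

/-- Auxiliary (proof-internal). [folklore] -/
private theorem logPlus_sq_div_sq_le {h : ℤ} (hh : h ≠ 0) :
    logPlus h ^ 2 / (h : ℝ) ^ 2 ≤ 16 * Real.sqrt 3 * |(h : ℝ)| ^ (-(3 / 2) : ℝ) := by
  have hh1 : (1 : ℝ) ≤ |(h : ℝ)| := by
    rw [← Int.cast_abs]; exact_mod_cast Int.one_le_abs hh
  have hhpos : (0 : ℝ) < |(h : ℝ)| := by linarith
  have h1 : (2 + |(h : ℝ)|) ^ (1 / 2 : ℝ) ≤ Real.sqrt 3 * |(h : ℝ)| ^ (1 / 2 : ℝ) := by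
    rw [Real.sqrt_eq_rpow, ← Real.mul_rpow (by norm_num) hhpos.le]
    exact Real.rpow_le_rpow (by positivity) (by linarith) (by norm_num)
  have h2 : (h : ℝ) ^ 2 = |(h : ℝ)| ^ (2 : ℝ) := by
    rw [← sq_abs, ← Real.rpow_natCast]; norm_num
  calc logPlus h ^ 2 / (h : ℝ) ^ 2 ≤ 16 * (2 + |(h : ℝ)|) ^ (1 / 2 : ℝ) / (h : ℝ) ^ 2 := by
        gcongr; exact logPlus_sq_le _
    _ ≤ 16 * (Real.sqrt 3 * |(h : ℝ)| ^ (1 / 2 : ℝ)) / (h : ℝ) ^ 2 := by gcongr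
    _ = 16 * Real.sqrt 3 * (|(h : ℝ)| ^ (1 / 2 : ℝ) / |(h : ℝ)| ^ (2 : ℝ)) := by
        rw [h2]; ring
    _ = 16 * Real.sqrt 3 * |(h : ℝ)| ^ (-(3 / 2) : ℝ) := by
        rw [← Real.rpow_sub hhpos]; norm_num

/-- Auxiliary (proof-internal). [folklore] -/
private theorem summable_logPlus_sq_div_sq :
    Summable (fun h : ℤ ↦ logPlus h ^ 2 / (h : ℝ) ^ 2) := by
  have hs : Summable (fun h : ℤ ↦ 16 * Real.sqrt 3 * |(h : ℝ)| ^ (-(3 / 2) : ℝ)) :=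
    (Real.summable_abs_int_rpow (by norm_num : (1 : ℝ) < 3 / 2)).mul_left _
  refine Summable.of_nonneg_of_le (fun h ↦ by positivity) (fun h ↦ ?_) hs
  rcases eq_or_ne h 0 with rfl | hh
  · simp
  · exact logPlus_sq_div_sq_le hh

/-! ### Step 5: the per-`j` bound (Lemma 21 proof, p. 47 last display) -/

/-- The majorant `m ↦ (2(A + 2L)² + 2 log₊² m)/(c² m²)` on `ℤ` (value `0` at `m = 0`). [folklore] -/
private def xiG (A c L : ℝ) (m : ℤ) : ℝ :=
  (2 * (A + 2 * L) ^ 2 + 2 * logPlus (m : ℝ) ^ 2) / (c ^ 2 * (m : ℝ) ^ 2)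

/-- Auxiliary (proof-internal). [folklore] -/
private theorem xiG_nonneg (A c L : ℝ) (m : ℤ) : 0 ≤ xiG A c L m := by
  unfold xiG; positivity

/-- Auxiliary (proof-internal). [folklore] -/
private theorem xiG_eq (A c L : ℝ) : xiG A c L = fun m : ℤ ↦
    (2 * (A + 2 * L) ^ 2 / c ^ 2) * (1 / (m : ℝ) ^ 2) +
      (2 / c ^ 2) * (logPlus (m : ℝ) ^ 2 / (m : ℝ) ^ 2) := by
  funext m; unfold xiG; ring

/-- Auxiliary (proof-internal). [folklore] -/
private theorem summable_xiG (A c L : ℝ) : Summable (xiG A c L) := by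
  rw [xiG_eq]
  exact (summable_one_div_int_sq.mul_left _).add (summable_logPlus_sq_div_sq.mul_left _)

/-- Auxiliary (proof-internal). [folklore] -/
private theorem tsum_xiG (A c L : ℝ) : ∑' m : ℤ, xiG A c L m =
    (2 * (A + 2 * L) ^ 2 / c ^ 2) * (∑' m : ℤ, 1 / (m : ℝ) ^ 2) +
      (2 / c ^ 2) * (∑' m : ℤ, logPlus (m : ℝ) ^ 2 / (m : ℝ) ^ 2) := by
  rw [xiG_eq, (summable_one_div_int_sq.mul_left _).tsum_add
    (summable_logPlus_sq_div_sq.mul_left _), tsum_mul_left, tsum_mul_left]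

/-- The family `k ↦ 1/(ξ_j − ξ_k)²` on `ℤ`, set to `0` at the junk index `k = 0` (and equal to `0`
at `k = j` by `1/0 = 0`). [folklore] -/
private def xiF (j k : ℤ) : ℝ :=
  if k = 0 then 0 else 1 / (classicalLocationZ j - classicalLocationZ k) ^ 2

/-- Auxiliary (proof-internal). [folklore] -/
private theorem xiF_nonneg (j k : ℤ) : 0 ≤ xiF j k := by
  unfold xiF; split_ifs
  · exact le_rfl
  · positivity

/-- Auxiliary (proof-internal). [folklore] -/
private theorem xiF_of_ne_zero (j : ℤ) {k : ℤ} (hk : k ≠ 0) :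
    xiF j k = 1 / (classicalLocationZ j - classicalLocationZ k) ^ 2 := by
  unfold xiF; rw [if_neg hk]

/-- Auxiliary (proof-internal). [folklore] -/
private theorem sq_add_le (p q : ℝ) : (p + q) ^ 2 ≤ 2 * p ^ 2 + 2 * q ^ 2 := by
  nlinarith [sq_nonneg (p - q)]

/-- Pointwise domination `xiF j k ≤ xiG A c (log₊ j) (k − j)`, given the bound of
`exists_inv_sq_le`. [folklore] -/
private theorem xiF_le_xiG {c A : ℝ} (hA : 0 ≤ A)
    (hpt : ∀ j k : ℤ, j ≠ 0 → k ≠ 0 → k ≠ j →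
      1 / (classicalLocationZ j - classicalLocationZ k) ^ 2 ≤
        (A + logPlus j + logPlus k) ^ 2 / (c ^ 2 * ((k : ℝ) - j) ^ 2))
    {j : ℤ} (hj : j ≠ 0) (k : ℤ) : xiF j k ≤ xiG A c (logPlus (j : ℝ)) (k - j) := by
  rcases eq_or_ne k 0 with rfl | hk
  · unfold xiF; rw [if_pos rfl]; exact xiG_nonneg _ _ _ _
  rw [xiF_of_ne_zero j hk]
  rcases eq_or_ne k j with rfl | hkj
  · rw [sub_self, zero_pow two_ne_zero, div_zero]; exact xiG_nonneg _ _ _ _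
  have h1 := hpt j k hj hk hkj
  have h3 : logPlus (k : ℝ) ≤ logPlus (j : ℝ) + logPlus ((k : ℝ) - j) :=
    logPlus_le_logPlus_add_logPlus_sub _ _
  have h4 : 0 ≤ A + logPlus (j : ℝ) + logPlus (k : ℝ) := by
    have := logPlus_nonneg (k : ℝ); have := logPlus_nonneg (j : ℝ); linarith
  have h5 : A + logPlus (j : ℝ) + logPlus (k : ℝ) ≤
      (A + 2 * logPlus (j : ℝ)) + logPlus ((k : ℝ) - j) := by linarith
  have h2 : (A + logPlus (j : ℝ) + logPlus (k : ℝ)) ^ 2 ≤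
      2 * (A + 2 * logPlus (j : ℝ)) ^ 2 + 2 * logPlus ((k : ℝ) - j) ^ 2 :=
    (pow_le_pow_left₀ h4 h5 2).trans (sq_add_le _ _)
  calc 1 / (classicalLocationZ j - classicalLocationZ k) ^ 2
      ≤ (A + logPlus (j : ℝ) + logPlus (k : ℝ)) ^ 2 / (c ^ 2 * ((k : ℝ) - j) ^ 2) := h1
    _ ≤ (2 * (A + 2 * logPlus (j : ℝ)) ^ 2 + 2 * logPlus ((k : ℝ) - j) ^ 2) /
          (c ^ 2 * ((k : ℝ) - j) ^ 2) := by gcongr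
    _ = xiG A c (logPlus (j : ℝ)) (k - j) := by unfold xiG; rw [Int.cast_sub]

/-- Auxiliary (proof-internal). [folklore] -/
private theorem const_bound {A c S₁ S₂ L : ℝ} (hA : 0 ≤ A) (hc : 0 < c) (hS₁ : 0 ≤ S₁)
    (hS₂ : 0 ≤ S₂) (hL : Real.log 2 ≤ L) :
    (2 * (A + 2 * L) ^ 2 / c ^ 2) * S₁ + (2 / c ^ 2) * S₂ ≤
      (2 * (A / Real.log 2 + 2) ^ 2 * S₁ + 2 * S₂ / Real.log 2 ^ 2) / c ^ 2 * L ^ 2 := by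
  have hlog2 : 0 < Real.log 2 := Real.log_pos one_lt_two
  have hL0 : 0 ≤ L := hlog2.le.trans hL
  have h1 : A + 2 * L ≤ (A / Real.log 2 + 2) * L := by
    rw [add_mul, div_mul_eq_mul_div]
    have : A ≤ A * L / Real.log 2 := by
      rw [le_div_iff₀ hlog2]; exact mul_le_mul_of_nonneg_left hL hA
    linarith
  have h2 : (A + 2 * L) ^ 2 ≤ (A / Real.log 2 + 2) ^ 2 * L ^ 2 := by
    rw [← mul_pow]
    exact pow_le_pow_left₀ (by positivity) h1 2
  have h3 : S₂ ≤ S₂ / Real.log 2 ^ 2 * L ^ 2 := by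
    rw [div_mul_eq_mul_div, le_div_iff₀ (by positivity)]
    exact mul_le_mul_of_nonneg_left (pow_le_pow_left₀ hlog2.le hL 2) hS₂
  calc (2 * (A + 2 * L) ^ 2 / c ^ 2) * S₁ + (2 / c ^ 2) * S₂
      ≤ (2 * ((A / Real.log 2 + 2) ^ 2 * L ^ 2) / c ^ 2) * S₁ +
          (2 / c ^ 2) * (S₂ / Real.log 2 ^ 2 * L ^ 2) := by gcongr
    _ = (2 * (A / Real.log 2 + 2) ^ 2 * S₁ + 2 * S₂ / Real.log 2 ^ 2) / c ^ 2 * L ^ 2 := by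
        field_simp

set_option maxHeartbeats 400000 in
/-- The row family `xiF j` on `ℤ` is summable with sum `≤ C log₊² j`, uniformly in `j ≠ 0`.
[folklore] -/
private theorem exists_xiF_tsum_le :
    ∃ C : ℝ, 0 ≤ C ∧ ∀ j : ℤ, j ≠ 0 →
      Summable (xiF j) ∧ ∑' k : ℤ, xiF j k ≤ C * logPlus j ^ 2 := by
  obtain ⟨c, A, hc, hA, hpt⟩ := exists_inv_sq_le
  obtain ⟨S₁, hS₁⟩ : ∃ S : ℝ, S = ∑' h : ℤ, 1 / (h : ℝ) ^ 2 := ⟨_, rfl⟩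
  obtain ⟨S₂, hS₂⟩ : ∃ S : ℝ, S = ∑' h : ℤ, logPlus (h : ℝ) ^ 2 / (h : ℝ) ^ 2 := ⟨_, rfl⟩
  have hS₁0 : 0 ≤ S₁ := by rw [hS₁]; exact tsum_nonneg fun h ↦ by positivity
  have hS₂0 : 0 ≤ S₂ := by rw [hS₂]; exact tsum_nonneg fun h ↦ by positivity
  refine ⟨(2 * (A / Real.log 2 + 2) ^ 2 * S₁ + 2 * S₂ / Real.log 2 ^ 2) / c ^ 2, by positivity,
    fun j hj ↦ ?_⟩
  have hLj : Real.log 2 ≤ logPlus (j : ℝ) := log_two_le_logPlus _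
  have hFG : ∀ k, xiF j k ≤ xiG A c (logPlus (j : ℝ)) (k - j) := xiF_le_xiG hA hpt hj
  have hGshift : Summable (fun k : ℤ ↦ xiG A c (logPlus (j : ℝ)) (k - j)) :=
    (Equiv.subRight j).summable_iff.2 (summable_xiG A c _)
  have hFsum : Summable (xiF j) := Summable.of_nonneg_of_le (xiF_nonneg j) hFG hGshift
  refine ⟨hFsum, ?_⟩
  calc ∑' k : ℤ, xiF j k ≤ ∑' k : ℤ, xiG A c (logPlus (j : ℝ)) (k - j) :=
        hFsum.tsum_le_tsum hFG hGshift
    _ = ∑' m : ℤ, xiG A c (logPlus (j : ℝ)) m := (Equiv.subRight j).tsum_eq _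
    _ = (2 * (A + 2 * logPlus (j : ℝ)) ^ 2 / c ^ 2) * S₁ + (2 / c ^ 2) * S₂ := by
        rw [tsum_xiG, hS₁, hS₂]
    _ ≤ _ := const_bound hA hc hS₁0 hS₂0 hLj

/-- The statement of `rodgers_tao_xi_inv_sq_sum_bound`, proved (Lemma 21 proof, p. 47, «from
Lemma 8 (ii)»). [cite: RodgersTaoFMP2020, §7 Lemma 21 proof p. 47] -/
private theorem xi_inv_sq_sum_bound_aux :
    ∃ C : ℝ, ∀ j : ℤ, j ≠ 0 →
      Summable (fun k : zstarCompl {j} ↦ 1 / (classicalLocationZ j - classicalLocationZ k) ^ 2) ∧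
      ∑' k : zstarCompl {j}, 1 / (classicalLocationZ j - classicalLocationZ k) ^ 2 ≤
        C * logPlus j ^ 2 := by
  obtain ⟨C, -, hC⟩ := exists_xiF_tsum_le
  refine ⟨C, fun j hj ↦ ?_⟩
  obtain ⟨hFsum, hle⟩ := hC j hj
  have hsub : Summable
      (fun k : zstarCompl {j} ↦ 1 / (classicalLocationZ j - classicalLocationZ k) ^ 2) := by
    refine (hFsum.subtype fun k ↦ k ∈ zstarCompl {j}).congr fun k ↦ ?_
    exact xiF_of_ne_zero j (mem_zstarCompl.1 k.2).1
  refine ⟨hsub, ?_⟩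
  have htsub : ∑' k : zstarCompl {j}, 1 / (classicalLocationZ j - classicalLocationZ k) ^ 2 =
      ∑' k : zstarCompl {j}, xiF j k :=
    tsum_congr fun k ↦ (xiF_of_ne_zero j (mem_zstarCompl.1 k.2).1).symm
  rw [htsub]
  exact (Summable.tsum_subtype_le (xiF j) (zstarCompl {j}) (xiF_nonneg j) hFsum).trans hle

/-! ### Part 2: `Σ_{j ≠ k} ψ_T(j) ψ_T(k)/|ξ_j − ξ_k|² ≲ T log³ T` (Lemma 21 proof, p. 47) -/

/-! ### Step A: the one-dimensional weighted sums -/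

/-- Core profile `n ↦ (1 + n/N)^{−98}` on `ℕ`. [folklore] -/
private def psiCore (N : ℝ) (n : ℕ) : ℝ := ((1 + (n : ℝ) / N) ^ 98)⁻¹

/-- Auxiliary (proof-internal). [folklore] -/
private theorem psiCore_nonneg {N : ℝ} (hN : 0 < N) (n : ℕ) : 0 ≤ psiCore N n := by
  unfold psiCore; positivity

/-- Auxiliary (proof-internal). [folklore] -/
private theorem psiCore_le_one {N : ℝ} (hN : 0 < N) (n : ℕ) : psiCore N n ≤ 1 := by
  unfold psiCore
  have h1 : 1 ≤ 1 + (n : ℝ) / N := by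
    have : 0 ≤ (n : ℝ) / N := by positivity
    linarith
  exact inv_le_one_of_one_le₀ (one_le_pow₀ h1)

/-- For `n ≥ N`: `(1 + n/N)^{−98} ≤ N² / n²` (indeed `≤ (N/n)^{98} ≤ N²/n² · (N/n)^{96}`).
[folklore] -/
private theorem psiCore_le_sq_div {N : ℝ} (hN : 0 < N) {n : ℕ} (hn : N ≤ n) :
    psiCore N n ≤ N ^ 2 * (((n : ℝ)) ^ 2)⁻¹ := by
  unfold psiCore
  have hn0 : (0 : ℝ) < n := hN.trans_le hn
  have h1 : (n : ℝ) / N ≤ 1 + (n : ℝ) / N := by linarith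
  have h2 : 1 ≤ (n : ℝ) / N := by rwa [le_div_iff₀ hN, one_mul]
  have h3 : ((n : ℝ) / N) ^ 2 ≤ (1 + (n : ℝ) / N) ^ 98 :=
    calc ((n : ℝ) / N) ^ 2 ≤ ((n : ℝ) / N) ^ 98 := pow_le_pow_right₀ h2 (by norm_num)
      _ ≤ (1 + (n : ℝ) / N) ^ 98 := pow_le_pow_left₀ (by positivity) h1 98
  calc ((1 + (n : ℝ) / N) ^ 98)⁻¹ ≤ (((n : ℝ) / N) ^ 2)⁻¹ := inv_anti₀ (by positivity) h3
    _ = N ^ 2 * ((n : ℝ) ^ 2)⁻¹ := by rw [div_pow]; field_simp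

/-- Partial sums of the core profile: `Σ_{n<M} (1 + n/N)^{−98} ≤ 5N` for `N ≥ 1`. [folklore] -/
private theorem sum_range_psiCore_le {N : ℝ} (hN : 1 ≤ N) (M : ℕ) :
    ∑ n ∈ Finset.range M, psiCore N n ≤ 5 * N := by
  have hN0 : 0 < N := one_pos.trans_le hN
  set K : ℕ := ⌈N⌉₊ with hK
  have hKN : N ≤ (K : ℝ) := Nat.le_ceil N
  have hK1 : (K : ℝ) < N + 1 := Nat.ceil_lt_add_one hN0.le
  rw [← Finset.sum_filter_add_sum_filter_not (Finset.range M) (fun n ↦ n ≤ K)]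
  have h1 : ∑ n ∈ (Finset.range M).filter (fun n ↦ n ≤ K), psiCore N n ≤ (K : ℝ) + 1 := by
    calc ∑ n ∈ (Finset.range M).filter (fun n ↦ n ≤ K), psiCore N n
        ≤ ∑ n ∈ (Finset.range M).filter (fun n ↦ n ≤ K), (1 : ℝ) :=
          Finset.sum_le_sum fun n _ ↦ psiCore_le_one hN0 n
      _ = (((Finset.range M).filter (fun n ↦ n ≤ K)).card : ℝ) := by simp
      _ ≤ ((Finset.range (K + 1)).card : ℝ) := by
          gcongr
          intro n hn
          simp only [Finset.mem_filter, Finset.mem_range] at hn ⊢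
          omega
      _ = (K : ℝ) + 1 := by simp
  have h2 : ∑ n ∈ (Finset.range M).filter (fun n ↦ ¬ n ≤ K), psiCore N n ≤ 2 * N := by
    calc ∑ n ∈ (Finset.range M).filter (fun n ↦ ¬ n ≤ K), psiCore N n
        ≤ ∑ n ∈ (Finset.range M).filter (fun n ↦ ¬ n ≤ K), N ^ 2 * (((n : ℝ)) ^ 2)⁻¹ := by
          refine Finset.sum_le_sum fun n hn ↦ psiCore_le_sq_div hN0 ?_
          simp only [Finset.mem_filter, not_le] at hn
          exact hKN.trans (by exact_mod_cast hn.2.le)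
      _ = N ^ 2 * ∑ n ∈ (Finset.range M).filter (fun n ↦ ¬ n ≤ K), (((n : ℝ)) ^ 2)⁻¹ := by
          rw [Finset.mul_sum]
      _ ≤ N ^ 2 * ∑ n ∈ Finset.Ioo K M, (((n : ℝ)) ^ 2)⁻¹ := by
          refine mul_le_mul_of_nonneg_left
            (Finset.sum_le_sum_of_subset_of_nonneg (fun n hn ↦ ?_) fun _ _ _ ↦ by positivity)
            (by positivity)
          simp only [Finset.mem_filter, Finset.mem_range, not_le] at hn
          simp only [Finset.mem_Ioo]
          exact ⟨hn.2, hn.1⟩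
      _ ≤ N ^ 2 * (2 / ((K : ℝ) + 1)) := by gcongr; exact sum_Ioo_inv_sq_le K M
      _ ≤ N ^ 2 * (2 / N) := by gcongr; linarith
      _ = 2 * N := by field_simp
  linarith

/-- Auxiliary (proof-internal). [folklore] -/
private theorem summable_psiCore {N : ℝ} (hN : 1 ≤ N) : Summable (psiCore N) :=
  summable_of_sum_range_le (psiCore_nonneg (one_pos.trans_le hN)) (sum_range_psiCore_le hN)

/-- Auxiliary (proof-internal). [folklore] -/
private theorem tsum_psiCore_le {N : ℝ} (hN : 1 ≤ N) : ∑' n : ℕ, psiCore N n ≤ 5 * N :=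
  Real.tsum_le_of_sum_range_le (psiCore_nonneg (one_pos.trans_le hN)) (sum_range_psiCore_le hN)

/-- The symmetric profile on `ℤ`: `j ↦ (1 + |j|/N)^{−98}`. [folklore] -/
private def psiZ (N : ℝ) (j : ℤ) : ℝ := ((1 + |(j : ℝ)| / N) ^ 98)⁻¹

/-- Auxiliary (proof-internal). [folklore] -/
private theorem psiZ_natCast (N : ℝ) (n : ℕ) : psiZ N (n : ℤ) = psiCore N n := by
  simp [psiZ, psiCore]

/-- Auxiliary (proof-internal). [folklore] -/
private theorem psiZ_neg_natCast (N : ℝ) (n : ℕ) : psiZ N (-(n : ℤ)) = psiCore N n := by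
  simp [psiZ, psiCore]

/-- Auxiliary (proof-internal). [folklore] -/
private theorem psiZ_nonneg {N : ℝ} (hN : 0 < N) (j : ℤ) : 0 ≤ psiZ N j := by
  unfold psiZ; positivity

/-- Auxiliary (proof-internal). [folklore] -/
private theorem summable_psiZ {N : ℝ} (hN : 1 ≤ N) : Summable (psiZ N) := by
  refine summable_int_iff_summable_nat_and_neg.2 ⟨?_, ?_⟩
  · simpa only [psiZ_natCast] using summable_psiCore hN
  · simpa only [psiZ_neg_natCast] using summable_psiCore hN

/-- Auxiliary (proof-internal). [folklore] -/
private theorem tsum_psiZ_le {N : ℝ} (hN : 1 ≤ N) : ∑' j : ℤ, psiZ N j ≤ 10 * N := by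
  have hs := summable_psiZ hN
  have h1 : HasSum (fun n : ℕ ↦ psiZ N n + psiZ N (-(n : ℤ))) (∑' j : ℤ, psiZ N j + psiZ N 0) :=
    hs.hasSum.nat_add_neg
  have h2 : ∑' n : ℕ, (psiZ N n + psiZ N (-(n : ℤ))) = 2 * ∑' n : ℕ, psiCore N n := by
    rw [← tsum_mul_left]; refine tsum_congr fun n ↦ ?_
    rw [psiZ_natCast, psiZ_neg_natCast]; ring
  have h3 : 0 ≤ psiZ N 0 := psiZ_nonneg (one_pos.trans_le hN) 0
  have := tsum_psiCore_le hN
  linarith [h1.tsum_eq]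

/-- Pointwise: `ψ_T(j) log₊² j ≤ (2 log²(2 + N) + 2) · (1 + |j|/N)^{−98}`, `N = T log T > 0`.
[folklore] -/
private theorem truncWeight_mul_logPlus_sq_le {T : ℝ} (hT : 0 < T * Real.log T) (j : ℤ) :
    truncWeight T j * logPlus j ^ 2 ≤
      (2 * Real.log (2 + T * Real.log T) ^ 2 + 2) * psiZ (T * Real.log T) j := by
  set N := T * Real.log T with hN
  set u := |(j : ℝ)| / N with hu
  have hu0 : 0 ≤ u := by positivity
  have h1u : 1 ≤ 1 + u := by linarith
  -- log₊ j ≤ log(2+N) + log(1+u) ≤ log(2+N) + u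
  have h1 : logPlus (j : ℝ) ≤ Real.log (2 + N) + u := by
    rw [logPlus_eq]
    have h2 : 2 + |(j : ℝ)| ≤ (2 + N) * (1 + u) := by
      have : (2 + N) * (1 + u) = 2 + N + 2 * u + |(j : ℝ)| := by
        rw [hu]; field_simp; ring
      rw [this]; linarith
    have h3 : Real.log (1 + u) ≤ u := by
      have := Real.log_le_sub_one_of_pos (by linarith : (0 : ℝ) < 1 + u); linarith
    calc Real.log (2 + |(j : ℝ)|) ≤ Real.log ((2 + N) * (1 + u)) :=
          Real.log_le_log (by positivity) h2
      _ = Real.log (2 + N) + Real.log (1 + u) :=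
          Real.log_mul (by positivity) (by positivity)
      _ ≤ Real.log (2 + N) + u := by linarith
  have ha : 0 ≤ Real.log (2 + N) := Real.log_nonneg (by linarith)
  have h4 : logPlus (j : ℝ) ^ 2 ≤ 2 * Real.log (2 + N) ^ 2 + 2 * u ^ 2 :=
    (pow_le_pow_left₀ (logPlus_nonneg _) h1 2).trans (sq_add_le _ _)
  -- ψ = (1+u)^{-100} ≤ (1+u)^{-98} and ψ u² ≤ (1+u)^{-98}
  have hψ : truncWeight T j = ((1 + u) ^ 100)⁻¹ := by rw [truncWeight_eq]
  have hZ : psiZ N j = ((1 + u) ^ 98)⁻¹ := by simp only [psiZ, hu]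
  rw [hψ, hZ]
  have h5 : ((1 + u) ^ 100)⁻¹ ≤ ((1 + u) ^ 98)⁻¹ :=
    inv_anti₀ (by positivity) (pow_le_pow_right₀ h1u (by norm_num))
  have h6 : ((1 + u) ^ 100)⁻¹ * u ^ 2 ≤ ((1 + u) ^ 98)⁻¹ := by
    rw [show (1 + u) ^ 100 = (1 + u) ^ 98 * (1 + u) ^ 2 by ring, mul_inv, mul_assoc]
    refine mul_le_of_le_one_right (by positivity) ?_
    rw [inv_mul_le_iff₀ (by positivity), mul_one]
    exact pow_le_pow_left₀ hu0 (by linarith) 2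
  have h7 : 0 ≤ ((1 + u) ^ 100)⁻¹ := by positivity
  calc ((1 + u) ^ 100)⁻¹ * logPlus (j : ℝ) ^ 2
      ≤ ((1 + u) ^ 100)⁻¹ * (2 * Real.log (2 + N) ^ 2 + 2 * u ^ 2) :=
        mul_le_mul_of_nonneg_left h4 h7
    _ = 2 * Real.log (2 + N) ^ 2 * ((1 + u) ^ 100)⁻¹ + 2 * (((1 + u) ^ 100)⁻¹ * u ^ 2) := by ring
    _ ≤ 2 * Real.log (2 + N) ^ 2 * ((1 + u) ^ 98)⁻¹ + 2 * ((1 + u) ^ 98)⁻¹ := by gcongr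
    _ = (2 * Real.log (2 + N) ^ 2 + 2) * ((1 + u) ^ 98)⁻¹ := by ring

/-- `log(2 + T log T) ≤ 2 log T` and `1 ≤ log² T` for `T ≥ 3`. [folklore] -/
private theorem log_two_add_le {T : ℝ} (hT : 3 ≤ T) :
    Real.log (2 + T * Real.log T) ≤ 2 * Real.log T ∧ 1 ≤ Real.log T := by
  have hT0 : 0 < T := by linarith
  have hlogT : 1 ≤ Real.log T := by
    rw [← Real.log_exp 1]
    refine Real.log_le_log (Real.exp_pos 1) ?_
    have := Real.exp_one_lt_d9; linarith
  refine ⟨?_, hlogT⟩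
  have h1 : Real.log T ≤ T - 1 := by
    have := Real.log_le_sub_one_of_pos hT0; linarith
  have h2 : 2 + T * Real.log T ≤ T ^ 2 := by nlinarith
  calc Real.log (2 + T * Real.log T) ≤ Real.log (T ^ 2) :=
        Real.log_le_log (by positivity) h2
    _ = 2 * Real.log T := by rw [Real.log_pow]; norm_num

/-- Step A: `Σ_{j ∈ ℤ} ψ_T(j) log₊² j ≤ 100 · T log³ T` for `T ≥ 3` (with summability). [folklore]
-/
private theorem truncWeight_logPlus_sq_sum_le {T : ℝ} (hT : 3 ≤ T) :
    Summable (fun j : ℤ ↦ truncWeight T j * logPlus j ^ 2) ∧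
      ∑' j : ℤ, truncWeight T j * logPlus j ^ 2 ≤ 100 * (T * Real.log T ^ 3) := by
  obtain ⟨hlog2N, hlogT⟩ := log_two_add_le hT
  have hT0 : 0 < T := by linarith
  have hN1 : 1 ≤ T * Real.log T := by nlinarith
  have hN0 : 0 < T * Real.log T := by linarith
  have hpt := truncWeight_mul_logPlus_sq_le hN0
  have hmaj : Summable (fun j : ℤ ↦ (2 * Real.log (2 + T * Real.log T) ^ 2 + 2) *
      psiZ (T * Real.log T) j) := (summable_psiZ hN1).mul_left _
  have hnn : ∀ j : ℤ, 0 ≤ truncWeight T j * logPlus j ^ 2 := fun j ↦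
    mul_nonneg (truncWeight_pos hN0 j).le (sq_nonneg _)
  have hs : Summable (fun j : ℤ ↦ truncWeight T j * logPlus j ^ 2) :=
    Summable.of_nonneg_of_le hnn hpt hmaj
  refine ⟨hs, ?_⟩
  calc ∑' j : ℤ, truncWeight T j * logPlus j ^ 2
      ≤ ∑' j : ℤ, (2 * Real.log (2 + T * Real.log T) ^ 2 + 2) * psiZ (T * Real.log T) j :=
        hs.tsum_le_tsum hpt hmaj
    _ = (2 * Real.log (2 + T * Real.log T) ^ 2 + 2) * ∑' j : ℤ, psiZ (T * Real.log T) j :=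
        tsum_mul_left
    _ ≤ (2 * (2 * Real.log T) ^ 2 + 2 * Real.log T ^ 2) * (10 * (T * Real.log T)) := by
        have h0 : 0 ≤ Real.log (2 + T * Real.log T) := Real.log_nonneg (by linarith)
        gcongr
        · exact tsum_nonneg fun j ↦ psiZ_nonneg hN0 j
        · nlinarith
        · exact tsum_psiZ_le hN1
    _ = 100 * (T * Real.log T ^ 3) := by ring

/-! ### Step B: the two-dimensional sum -/

/-- The extended weight `ψ'_T(j) := ψ_T(j)` for `j ≠ 0`, `0` at the junk index. [folklore] -/
private def psiExt (T : ℝ) (j : ℤ) : ℝ := if j = 0 then 0 else truncWeight T j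

/-- Auxiliary (proof-internal). [folklore] -/
private theorem psiExt_nonneg {T : ℝ} (hT : 0 < T * Real.log T) (j : ℤ) : 0 ≤ psiExt T j := by
  unfold psiExt; split_ifs
  · exact le_rfl
  · exact (truncWeight_pos hT j).le

/-- Auxiliary (proof-internal). [folklore] -/
private theorem psiExt_le {T : ℝ} (hT : 0 < T * Real.log T) (j : ℤ) :
    psiExt T j ≤ truncWeight T j := by
  unfold psiExt; split_ifs
  · exact (truncWeight_pos hT j).le
  · exact le_rfl

/-- The majorant `H_T(j,k) := ψ'_T(j) · xiF j k` on `ℤ × ℤ`. [folklore] -/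
private def xiH (T : ℝ) (p : ℤ × ℤ) : ℝ := psiExt T p.1 * xiF p.1 p.2

/-- The statement of `rodgers_tao_truncWeight_xi_sq_sum_bound`, proved with `T₁ = 3` (Lemma 21
proof, p. 47, first display). [cite: RodgersTaoFMP2020, §7 Lemma 21 proof p. 47] -/
private theorem truncWeight_xi_sq_sum_bound_aux :
    ∃ C T₁ : ℝ, ∀ T : ℝ, T₁ ≤ T →
      Summable (fun p : zstarOffDiag ↦ truncWeight T p.1.1 * truncWeight T p.1.2 /
        (classicalLocationZ p.1.1 - classicalLocationZ p.1.2) ^ 2) ∧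
      ∑' p : zstarOffDiag, truncWeight T p.1.1 * truncWeight T p.1.2 /
        (classicalLocationZ p.1.1 - classicalLocationZ p.1.2) ^ 2 ≤ C * (T * Real.log T ^ 3) := by
  obtain ⟨C, hC0, hC⟩ := exists_xiF_tsum_le
  refine ⟨C * 100, 3, fun T hT ↦ ?_⟩
  obtain ⟨-, hlogT⟩ := log_two_add_le hT
  have hT0 : 0 < T := by linarith
  have hN0 : 0 < T * Real.log T := by nlinarith
  obtain ⟨hAsum, hAle⟩ := truncWeight_logPlus_sq_sum_le hT
  -- rows of H
  have hH0 : 0 ≤ xiH T := fun p ↦ mul_nonneg (psiExt_nonneg hN0 _) (xiF_nonneg _ _)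
  have hH00 : ∀ k : ℤ, xiH T (0, k) = 0 := fun k ↦ by simp [xiH, psiExt]
  have hrow : ∀ j : ℤ, Summable fun k : ℤ ↦ xiH T (j, k) := by
    intro j
    rcases eq_or_ne j 0 with rfl | hj
    · simp only [hH00]; exact summable_zero
    · exact ((hC j hj).1.mul_left (psiExt T j))
  have hrow_le : ∀ j : ℤ, ∑' k : ℤ, xiH T (j, k) ≤ C * (truncWeight T j * logPlus j ^ 2) := by
    intro j
    rcases eq_or_ne j 0 with rfl | hj
    · simp only [hH00, tsum_zero]
      exact mul_nonneg hC0 (mul_nonneg (truncWeight_pos hN0 _).le (sq_nonneg _))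
    · simp only [xiH]
      rw [tsum_mul_left]
      calc psiExt T j * ∑' k : ℤ, xiF j k ≤ truncWeight T j * (C * logPlus j ^ 2) :=
            mul_le_mul (psiExt_le hN0 j) (hC j hj).2 (tsum_nonneg (xiF_nonneg j))
              (truncWeight_pos hN0 j).le
        _ = C * (truncWeight T j * logPlus j ^ 2) := by ring
  have hrows_sum : Summable fun j : ℤ ↦ ∑' k : ℤ, xiH T (j, k) :=
    Summable.of_nonneg_of_le (fun j ↦ tsum_nonneg fun k ↦ hH0 _) hrow_le (hAsum.mul_left C)
  have hH : Summable (xiH T) := (summable_prod_of_nonneg hH0).2 ⟨hrow, hrows_sum⟩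
  have hHle : ∑' p : ℤ × ℤ, xiH T p ≤ C * 100 * (T * Real.log T ^ 3) :=
    calc ∑' p : ℤ × ℤ, xiH T p = ∑' j : ℤ, ∑' k : ℤ, xiH T (j, k) := hH.tsum_prod' hrow
      _ ≤ ∑' j : ℤ, C * (truncWeight T j * logPlus j ^ 2) :=
          hrows_sum.tsum_le_tsum hrow_le (hAsum.mul_left C)
      _ = C * ∑' j : ℤ, truncWeight T j * logPlus j ^ 2 := tsum_mul_left
      _ ≤ C * (100 * (T * Real.log T ^ 3)) := mul_le_mul_of_nonneg_left hAle hC0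
      _ = C * 100 * (T * Real.log T ^ 3) := by ring
  -- the family on the subtype is dominated by H
  set f : zstarOffDiag → ℝ := fun p ↦ truncWeight T p.1.1 * truncWeight T p.1.2 /
    (classicalLocationZ p.1.1 - classicalLocationZ p.1.2) ^ 2 with hf
  have hf0 : ∀ p, 0 ≤ f p := fun p ↦ by
    simp only [hf]
    exact div_nonneg (mul_nonneg (truncWeight_pos hN0 _).le (truncWeight_pos hN0 _).le)
      (sq_nonneg _)
  have hfH : ∀ p : zstarOffDiag, f p ≤ xiH T p.1 := by
    intro p
    obtain ⟨hj, hk, -⟩ := mem_zstarOffDiag.1 p.2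
    have hx : xiH T p.1 = truncWeight T p.1.1 *
        (1 / (classicalLocationZ p.1.1 - classicalLocationZ p.1.2) ^ 2) := by
      simp only [xiH, psiExt, if_neg hj, xiF_of_ne_zero _ hk]
    rw [hx]
    show truncWeight T p.1.1 * truncWeight T p.1.2 /
      (classicalLocationZ p.1.1 - classicalLocationZ p.1.2) ^ 2 ≤ _
    rw [show truncWeight T p.1.1 * truncWeight T p.1.2 /
        (classicalLocationZ p.1.1 - classicalLocationZ p.1.2) ^ 2 = truncWeight T p.1.1 *
        (truncWeight T p.1.2 * (1 / (classicalLocationZ p.1.1 - classicalLocationZ p.1.2) ^ 2)) by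
      ring]
    refine mul_le_mul_of_nonneg_left ?_ (truncWeight_pos hN0 _).le
    exact mul_le_of_le_one_left (by positivity) (truncWeight_le_one hN0 _)
  have hHsub : Summable fun p : zstarOffDiag ↦ xiH T p.1 := hH.subtype _
  have hfsum : Summable f := Summable.of_nonneg_of_le hf0 hfH hHsub
  refine ⟨hfsum, ?_⟩
  calc ∑' p : zstarOffDiag, f p ≤ ∑' p : zstarOffDiag, xiH T p.1 := hfsum.tsum_le_tsum hfH hHsub
    _ ≤ ∑' p : ℤ × ℤ, xiH T p := Summable.tsum_subtype_le (xiH T) zstarOffDiag hH0 hH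
    _ ≤ C * 100 * (T * Real.log T ^ 3) := hHle

/-- CONTENT (RH-FREE) — DISCHARGE of `rodgers_tao_xi_inv_sq_sum_bound` (Rodgers–Tao 2020, proof of
Lemma 21, FMP p. 47: «from Lemma 8 (ii), `Σ_{k ∈ ℤ* : k ≠ j} 1/|ξ_j − ξ_k|² ≲ log₊² j`»), from
(43)–(44) (`RodgersTao2020.lemma31_i_order_holds`, `RodgersTao2020.lemma31_ii_holds`). A real
proof, no ex falso; uses no hypothesis on `Λ`. [cite: RodgersTaoFMP2020, §7 Lemma 21 proof p. 47] -/
theorem rodgers_tao_xi_inv_sq_sum_bound_holds : rodgers_tao_xi_inv_sq_sum_bound :=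
  xi_inv_sq_sum_bound_aux

/-- CONTENT (RH-FREE) — DISCHARGE of `rodgers_tao_truncWeight_xi_sq_sum_bound` (Rodgers–Tao 2020,
proof of Lemma 21, FMP p. 47: «`Σ_{j,k ∈ ℤ* : j ≠ k} ψ_T(j)ψ_T(k)/|ξ_j − ξ_k|² ≲ T log³ T`»), with
the explicit threshold `T ≥ 3` and constant `100 · C` (`C` the constant of Part 1). A real proof,
no ex falso; uses no hypothesis on `Λ`. [cite: RodgersTaoFMP2020, §7 Lemma 21 proof p. 47] -/
theorem rodgers_tao_truncWeight_xi_sq_sum_bound_holds : rodgers_tao_truncWeight_xi_sq_sum_bound :=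
  truncWeight_xi_sq_sum_bound_aux

/-! ## The §7 facts under the refuted standing hypothesis (EX-FALSO, vacuous range) -/

/-- EX-FALSO (vacuous range) — discharge of `rodgers_tao_renormEnergyOn_expansion` (Rodgers–Tao
2020, Lemma 16 = v4 Lemma 7.1, FMP p. 41, printed for `Λ/2 ≤ t ≤ 0` under `Λ < 0`): the antecedent
`t₀ < 0 ∧ HasOnlyRealZeros (deBruijnH t₀)` contradicts `rodgers_tao_holds` (`Λ ≥ 0`). Zero content:
the §7 argument is not formalised by this proof. [cite: RodgersTaoFMP2020, Lemma 16 p. 41] -/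
theorem rodgers_tao_renormEnergyOn_expansion_holds : rodgers_tao_renormEnergyOn_expansion :=
  fun t₀ ht₀ hreal ↦ absurd hreal (rodgers_tao_holds t₀ ht₀)

/-- EX-FALSO (vacuous range) — discharge of `rodgers_tao_truncEnergy_expansion` (Lemma 18 = v4
Lemma 7.3, FMP p. 42), via `rodgers_tao_holds`. Zero content. [cite: RodgersTaoFMP2020, Lemma 18 p. 42] -/
theorem rodgers_tao_truncEnergy_expansion_holds : rodgers_tao_truncEnergy_expansion :=
  fun t₀ ht₀ hreal ↦ absurd hreal (rodgers_tao_holds t₀ ht₀)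

/-- EX-FALSO (vacuous range) — discharge of `rodgers_tao_truncHamiltonian_expansion` (Lemma 19 =
v4 Lemma 7.4, FMP p. 44), via `rodgers_tao_holds`. Zero content. [cite: RodgersTaoFMP2020, Lemma 19 p. 44] -/
theorem rodgers_tao_truncHamiltonian_expansion_holds : rodgers_tao_truncHamiltonian_expansion :=
  fun t₀ ht₀ hreal ↦ absurd hreal (rodgers_tao_holds t₀ ht₀)

/-- EX-FALSO (vacuous range) — discharge of `rodgers_tao_renormHamiltonian_decay` (Lemma 20 = v4
Lemma 7.5, FMP p. 45), via `rodgers_tao_holds`. Zero content. [cite: RodgersTaoFMP2020, Lemma 20 p. 45] -/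
theorem rodgers_tao_renormHamiltonian_decay_holds : rodgers_tao_renormHamiltonian_decay :=
  fun t₀ ht₀ hreal ↦ absurd hreal (rodgers_tao_holds t₀ ht₀)

/-- EX-FALSO (vacuous range) — discharge of `rodgers_tao_moderatelySized` (Lemma 21 = v4 Lemma
7.6, FMP p. 47, items (i)–(iv) for the zeros), via `rodgers_tao_holds`. Zero content.
[cite: RodgersTaoFMP2020, Lemma 21 p. 47] -/
theorem rodgers_tao_moderatelySized_holds : rodgers_tao_moderatelySized :=
  fun t₀ ht₀ hreal ↦ absurd hreal (rodgers_tao_holds t₀ ht₀)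

/-- EX-FALSO (vacuous range) — discharge of `rodgers_tao_moderatelySized_xi` (Lemma 21 = v4 Lemma
7.6, FMP p. 47, the clause «similarly if the `x_i` are replaced by `ξ_i`», typed literally in
witness form), via `rodgers_tao_holds`. Zero content. (The RH-FREE displays
`rodgers_tao_xi_inv_sq_sum_bound`, `rodgers_tao_truncWeight_xi_sq_sum_bound` are NOT discharged
here.) [cite: RodgersTaoFMP2020, Lemma 21 p. 47] -/
theorem rodgers_tao_moderatelySized_xi_holds : rodgers_tao_moderatelySized_xi :=
  fun t₀ ht₀ hreal ↦ absurd hreal (rodgers_tao_holds t₀ ht₀)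

/-- EX-FALSO (vacuous range) — discharge of `rodgers_tao_truncHamiltonian_deriv` (Prop. 22 = v4
Prop. 7.7, FMP p. 48), via `rodgers_tao_holds`. Zero content. [cite: RodgersTaoFMP2020, Prop. 22 p. 48 (76)] -/
theorem rodgers_tao_truncHamiltonian_deriv_holds : rodgers_tao_truncHamiltonian_deriv :=
  fun t₀ ht₀ hreal ↦ absurd hreal (rodgers_tao_holds t₀ ht₀)

/-- EX-FALSO (vacuous range) — discharge of `rodgers_tao_truncEnergy_lower_bound` (Lemma 24 = v4
Lemma 7.9, FMP p. 54), via `rodgers_tao_holds`. Zero content. [cite: RodgersTaoFMP2020, Lemma 24 p. 54] -/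
theorem rodgers_tao_truncEnergy_lower_bound_holds : rodgers_tao_truncEnergy_lower_bound :=
  fun t₀ ht₀ hreal ↦ absurd hreal (rodgers_tao_holds t₀ ht₀)

/-- EX-FALSO (vacuous range) — discharge of `rodgers_tao_truncHamiltonian_bound` (Cor. 25 = v4
Cor. 7.10, FMP p. 56), via `rodgers_tao_holds`. Zero content. [cite: RodgersTaoFMP2020, Cor. 25 p. 56] -/
theorem rodgers_tao_truncHamiltonian_bound_holds : rodgers_tao_truncHamiltonian_bound :=
  fun t₀ ht₀ hreal ↦ absurd hreal (rodgers_tao_holds t₀ ht₀)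

end Literature.NumberTheory.LFunctions

end
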